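import Summits.CriticalPhenomena.PercolationContinuityZ3.Theorems.Transplant.PlanarCells2TDefs
import Summits.CriticalPhenomena.PercolationContinuityZ3.Theorems.Transplant.PlanarCells2Contain
import HarnessLib

/-!
(R-40) SUCCESSOR `…T` (hp-8 g42, 2026-08-23; ruling p3-g16 06:23:56Z, J18): the twin of `PlanarCells2ContainS` over the PER-AXIS creep cap `PCells2T` (PlanarCells2TDefs:
`c i ≤ r (oth i)` instead of the uniform `c i ≤ cmax ≤ r j`); statements and proofs VERBATIM with `PCells2S ↦ PCells2T` (+ the renames of record of the T layer below it);
the only mathematical touch points are the places that read the cap, which only ever need the cross form `c (oth j) ≤ r j` (listed in the lane line of this file's landing).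
NO landed file is edited; `PlanarCells2ContainS` stays valid (and is an instance of this file through `PCells2S.toT`). NON-VACUITY: inherited verbatim from `PlanarCells2ContainS` (same witness line).

# STAGGERED two-unit planar cells `PCells2T` ((R-22) K-G geometry of record), part 2: containments — the `PCells2T` twin of `PlanarCells2Contain`
# (cubes, cells, between-boxes, stubs, faces, the corridor, the far rows, narrow ⊆ wide — every box about the staggered centre `cenS`)

WAVE-1 Geom re-base, first file (N2-SCOPE (R-22)/(R-27); stmt-g19's GEOM-REBASE-PRECENSUS §D order; CLAIM p3-g15 2026-08-22 21:00Z).  Every proof is the proof of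
`PlanarCells2Contain` (hp-8 g27) with `cen ↦ cenS`; where the NEIGHBOUR's centre enters (`cenS_add_stepVec_oth : cenS (v+δ) ⊥ = cenS v ⊥ + σ·c`), the transverse comparison
carries the creep `0 ≤ c δ.1 ≤ cmax ≤ r ⊥` (class (A) of the pre-census: true verbatim with `|c| ≤ r⊥`).  The three class-(B) far-region facts (`Efar ⊆ Btw ∪ Q′`,
`EfarN ⊆ BtwN ∪ Q′` — false verbatim for `c ≠ 0`) are NOT restated here: under (R-27) the far regions follow the neighbour (p5-g15's `PlanarCells2SFar`).
builds on p205010 (kernel theorem, internal audit signed; external expert review pending) — nothing in this file uses p205010.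
Lane `prim-bschramm`, seat `prim-bschramm-p3` (gen 15; N2 design owner); helper file (`--supports stmt-CriticalPhenomena-4575 --as helper`).  Statements in explicit-application form `PCells2T.X P` (the gate's dedup sees `PCells2`'s texts).
[cite: KozmaNitzan2024, §4 pp. 25–26 (Q_v, M_v, E_{v,x}, H^j_{v,x}), p. 30 (F^j_{v,x}) — the ℤ^d model, one unit]
-/

noncomputable section

namespace Summit.CriticalPhenomena.PercolationContinuityZ3.Theorems

namespace Transplant

open Literature.Probability.Percolation Literature.Probability.LatticeModels SimpleGraph GadgetSystem Contour
open Literature.Probability.Percolation.KozmaNitzan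
open Literature.Probability.Percolation.KozmaNitzan.Cells (oth oth_ne sgOf sgOf_sign stepVec_apply_fst stepVec_apply_oth eq_oth_of_ne oth_oth
  eq_of_coords)
open PCells (mem_psBox_iff)

namespace PCells2T

variable (P : PCells2T)

/-- The signed creep of a unit step is within one transverse unit: `−r⊥ ≤ σ·c δ.1 ≤ r⊥` (`0 ≤ c ≤ cmax ≤ r⊥`). [folklore] -/
theorem sg_c_bound (δ : MDir) : -((P : PCells2T).r (oth δ.1) : ℤ) ≤ sgOf δ * P.c δ.1 ∧ sgOf δ * P.c δ.1 ≤ P.r (oth δ.1) := by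
  have h0 := P.hc0 δ.1
  have h1 : P.c δ.1 ≤ P.r (oth δ.1) := P.hcr δ.1
  rcases sgOf_sign δ with hs | hs <;> rw [hs] <;> constructor <;> linarith

/-! ## Containments: cubes, cells, between-boxes, stubs -/

/-- `M_v ⊆ Q_v`. [folklore] -/
theorem M_subset_Q (v : Site 2) : PCells2T.M P v ⊆ PCells2T.Q P v := by
  intro t ht
  rw [M, mem_aboxS_iff] at ht
  rw [Q, mem_aboxS_iff]
  intro i; have := ht i; push_cast at this ⊢; constructor <;> omega

/-- `Q_v ⊆ Cell_v`. [folklore] -/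
theorem Q_subset_Cell (v : Site 2) : (PCells2T.Q P v : Finset (Site 2)) ⊆ PCells2T.Cell P v := by
  intro t ht
  rw [Q, mem_aboxS_iff] at ht
  rw [Cell, mem_aboxS_iff]
  intro i; have := ht i; push_cast at this ⊢; constructor <;> omega

/-- The centre of `x` lies in `Q_x`. [folklore] -/
theorem cenS_mem_Q (x : Site 2) : PCells2T.cenS P x ∈ PCells2T.Q P x := by
  rw [Q, mem_aboxS_iff]; intro i; push_cast; constructor <;> omega

/-- The centre of `x` lies in `M_x`. [folklore] -/
theorem cenS_mem_M (x : Site 2) : PCells2T.cenS P x ∈ PCells2T.M P x := by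
  rw [M, mem_aboxS_iff]; intro i; push_cast; constructor <;> omega

/-- `0 ∈ Q_0`. [folklore] -/
theorem zero_mem_Q_zero : (0 : Site 2) ∈ PCells2T.Q P 0 := by
  have h := P.cenS_mem_Q 0
  rwa [cenS_zero] at h

/-- `Btw_{v,δ} ⊆ Cell_v ∪ Cell_{v+δ}`. [folklore] -/
theorem Btw_subset_Cells (v : Site 2) (δ : MDir) : PCells2T.Btw P v δ ⊆ PCells2T.Cell P v ∪ PCells2T.Cell P (v + stepVec δ) := by
  intro t ht
  rw [Btw, mem_psBox_iff] at ht
  obtain ⟨⟨h1, h2⟩, h3, h4⟩ := ht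
  rw [Finset.mem_union, Cell, Cell, mem_aboxS_iff, mem_aboxS_iff]
  have hf := P.cenS_add_stepVec_fst v δ
  have ho := P.cenS_add_stepVec_oth v δ
  have hg := P.sg_c_bound δ
  by_cases hlev : sgOf δ * (t δ.1 - P.cenS v δ.1) ≤ 10 * P.r δ.1
  · left
    intro i
    rcases eq_or_ne i δ.1 with rfl | hi
    · rcases sgOf_sign δ with hs | hs <;> rw [hs] at h1 h2 hlev <;> push_cast <;> constructor <;> omega
    · rw [eq_oth_of_ne hi]; push_cast; constructor <;> omega
  · right
    intro i
    rcases eq_or_ne i δ.1 with rfl | hi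
    · rw [hf]
      rcases sgOf_sign δ with hs | hs <;> rw [hs] at h1 h2 hlev ⊢ <;> push_cast <;> constructor <;> omega
    · rw [eq_oth_of_ne hi, ho]; push_cast; constructor <;> omega

/-- `H^j ⊆ Q_v ∪ Btw` for `j + 1 ≤ K`. [folklore] -/
theorem Stub_subset_Q_union_Btw (v : Site 2) (δ : MDir) {j : ℕ} (hj : j < P.K) : (PCells2T.Stub P v δ j : Finset (Site 2)) ⊆ PCells2T.Q P v ∪ PCells2T.Btw P v δ := by
  intro t ht
  rw [Stub, mem_psBox_iff] at ht
  obtain ⟨⟨h1, h2⟩, h3, h4⟩ := ht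
  have hsj := PCells2.ten_s_mul_le_of_lt P.toPCells2 (a := δ.1) hj
  have hs1 := P.hs δ.1
  rw [Finset.mem_union, Q, mem_aboxS_iff, Btw, mem_psBox_iff]
  by_cases hlev : sgOf δ * (t δ.1 - P.cenS v δ.1) ≤ 5 * P.r δ.1
  · left
    intro i
    rcases eq_or_ne i δ.1 with rfl | hi
    · rcases sgOf_sign δ with hs | hs <;> rw [hs] at h1 hlev <;> push_cast <;> constructor <;> omega
    · rw [eq_oth_of_ne hi]; push_cast; constructor <;> omega
  · right
    refine ⟨⟨by omega, by omega⟩, by omega, by omega⟩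

/-- `H^j ⊆ Q_v ∪ BtwN` for `j + 1 ≤ K` (the stub has transverse half-width `2r⊥ ≤ 5r⊥ − 1`). [folklore] -/
theorem Stub_subset_Q_union_BtwN (v : Site 2) (δ : MDir) {j : ℕ} (hj : j < P.K) : (PCells2T.Stub P v δ j : Finset (Site 2)) ⊆ PCells2T.Q P v ∪ PCells2T.BtwN P v δ := by
  intro t ht
  rw [Stub, mem_psBox_iff] at ht
  obtain ⟨⟨h1, h2⟩, h3, h4⟩ := ht
  have hsj := PCells2.ten_s_mul_le_of_lt P.toPCells2 (a := δ.1) hj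
  have hs1 := P.hs δ.1
  have hr1 := P.one_le_r (oth δ.1)
  rw [Finset.mem_union, Q, mem_aboxS_iff, BtwN, mem_psBox_iff]
  by_cases hlev : sgOf δ * (t δ.1 - P.cenS v δ.1) ≤ 5 * P.r δ.1
  · left
    intro i
    rcases eq_or_ne i δ.1 with rfl | hi
    · rcases sgOf_sign δ with hs | hs <;> rw [hs] at h1 hlev <;> push_cast <;> constructor <;> omega
    · rw [eq_oth_of_ne hi]; push_cast; constructor <;> omega
  · right
    refine ⟨⟨by omega, by omega⟩, by omega, by omega⟩

/-- `H^j ⊆ Cell_v ∪ Zone` for `j + 1 ≤ K`. [folklore] -/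
theorem Stub_subset_Cell_union_Zone (v : Site 2) (δ : MDir) {j : ℕ} (hj : j < P.K) :
    (PCells2T.Stub P v δ j : Finset (Site 2)) ⊆ PCells2T.Cell P v ∪ PCells2T.Zone P v δ := by
  intro t ht
  rw [Stub, mem_psBox_iff] at ht
  obtain ⟨⟨h1, h2⟩, h3, h4⟩ := ht
  have hsj := PCells2.ten_s_mul_le_of_lt P.toPCells2 (a := δ.1) hj
  rw [Finset.mem_union, Cell, mem_aboxS_iff, Zone, mem_psBox_iff]
  by_cases hlev : sgOf δ * (t δ.1 - P.cenS v δ.1) ≤ 10 * P.r δ.1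
  · left
    intro i
    rcases eq_or_ne i δ.1 with rfl | hi
    · rcases sgOf_sign δ with hs | hs <;> rw [hs] at h1 hlev <;> push_cast <;> constructor <;> omega
    · rw [eq_oth_of_ne hi]; push_cast; constructor <;> omega
  · right
    refine ⟨⟨by omega, by omega⟩, by omega, by omega⟩

/-! ## Containments: faces, corridor, far rows -/

/-- The face of level `j` lies in the stub of level `j`. [folklore] -/
theorem Face_subset_Stub (v : Site 2) (δ : MDir) (j : ℕ) : (PCells2T.Face P v δ j : Finset (Site 2)) ⊆ PCells2T.Stub P v δ j := by
  intro t ht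
  rw [Face, mem_psBox_iff] at ht
  rw [Stub, mem_psBox_iff]
  obtain ⟨⟨h1, h2⟩, h3, h4⟩ := ht
  have : (0 : ℤ) ≤ 10 * P.s δ.1 * j := by positivity
  exact ⟨⟨by omega, h2⟩, h3, h4⟩

/-- Stubs of level `≤ K` lie in the full corridor (`10 s∥ K = 10 r∥`). [folklore] -/
theorem Stub_subset_Hfull (v : Site 2) (δ : MDir) {j : ℕ} (hj : j ≤ P.K) : (PCells2T.Stub P v δ j : Finset (Site 2)) ⊆ PCells2T.Hfull P v δ := by
  intro t ht
  rw [Stub, mem_psBox_iff] at ht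
  rw [Hfull, mem_psBox_iff]
  obtain ⟨⟨h1, h2⟩, h3, h4⟩ := ht
  have hsj := P.s_mul_le_r (i := δ.1) hj
  exact ⟨⟨h1, by nlinarith⟩, h3, h4⟩

/-- The full corridor lies in `Q_v ∪ E^far_{v,x}`. [folklore] -/
theorem Hfull_subset_Q_union_Efar (v : Site 2) (δ : MDir) : (PCells2T.Hfull P v δ : Finset (Site 2)) ⊆ PCells2T.Q P v ∪ PCells2T.Efar P v δ := by
  intro t ht
  rw [Hfull, mem_psBox_iff] at ht
  obtain ⟨⟨h1, h2⟩, h3, h4⟩ := ht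
  rw [Finset.mem_union, Q, mem_aboxS_iff, Efar, mem_psBox_iff]
  by_cases hlev : sgOf δ * (t δ.1 - P.cenS v δ.1) ≤ 5 * P.r δ.1
  · left
    intro i
    rcases eq_or_ne i δ.1 with rfl | hi
    · rcases sgOf_sign δ with hs | hs <;> rw [hs] at h1 hlev <;> push_cast <;> constructor <;> omega
    · rw [eq_oth_of_ne hi]; push_cast; constructor <;> omega
  · right
    exact ⟨⟨by omega, by omega⟩, by omega, by omega⟩

/-- The full corridor lies in `Q_v ∪ EfarN_{v,x}` (corridor half-width `2r⊥ ≤ 5r⊥ − 1`). [folklore] -/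
theorem Hfull_subset_Q_union_EfarN (v : Site 2) (δ : MDir) : (PCells2T.Hfull P v δ : Finset (Site 2)) ⊆ PCells2T.Q P v ∪ PCells2T.EfarN P v δ := by
  intro t ht
  rw [Hfull, mem_psBox_iff] at ht
  obtain ⟨⟨h1, h2⟩, h3, h4⟩ := ht
  have hr1 := P.one_le_r (oth δ.1)
  rw [Finset.mem_union, Q, mem_aboxS_iff, EfarN, mem_psBox_iff]
  by_cases hlev : sgOf δ * (t δ.1 - P.cenS v δ.1) ≤ 5 * P.r δ.1
  · left
    intro i
    rcases eq_or_ne i δ.1 with rfl | hi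
    · rcases sgOf_sign δ with hs | hs <;> rw [hs] at h1 hlev <;> push_cast <;> constructor <;> omega
    · rw [eq_oth_of_ne hi]; push_cast; constructor <;> omega
  · right
    exact ⟨⟨by omega, by omega⟩, by omega, by omega⟩

/-- The target cube lies in the far region: `M_{v+δ} ⊆ E^far_{v,δ}`. [folklore] -/
theorem M_add_stepVec_subset_Efar (v : Site 2) (δ : MDir) : (PCells2T.M P (v + stepVec δ) : Finset (Site 2)) ⊆ PCells2T.Efar P v δ := by
  intro t ht
  rw [M, mem_aboxS_iff] at ht
  rw [Efar, mem_psBox_iff]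
  have hf := P.cenS_add_stepVec_fst v δ
  have ho := P.cenS_add_stepVec_oth v δ
  have hg := P.sg_c_bound δ
  have ha := ht δ.1
  have hb := ht (oth δ.1)
  rw [hf] at ha
  rw [ho] at hb
  push_cast at ha hb
  have hr : (1 : ℤ) ≤ P.r δ.1 := by exact_mod_cast P.one_le_r δ.1
  refine ⟨?_, by omega, by omega⟩
  rcases sgOf_sign δ with hs | hs <;> rw [hs] at ha ⊢ <;> constructor <;> omega

/-- `M_{v+δ} ⊆ EfarN_{v,δ}` (`3r⊥ ≤ 5r⊥ − 1`). [folklore] -/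
theorem M_add_stepVec_subset_EfarN (v : Site 2) (δ : MDir) : (PCells2T.M P (v + stepVec δ) : Finset (Site 2)) ⊆ PCells2T.EfarN P v δ := by
  intro t ht
  rw [M, mem_aboxS_iff] at ht
  rw [EfarN, mem_psBox_iff]
  have hf := P.cenS_add_stepVec_fst v δ
  have ho := P.cenS_add_stepVec_oth v δ
  have hg := P.sg_c_bound δ
  have ha := ht δ.1
  have hb := ht (oth δ.1)
  rw [hf] at ha
  rw [ho] at hb
  push_cast at ha hb
  have hr : (1 : ℤ) ≤ P.r δ.1 := by exact_mod_cast P.one_le_r δ.1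
  have hr' : (1 : ℤ) ≤ P.r (oth δ.1) := by exact_mod_cast P.one_le_r (oth δ.1)
  refine ⟨?_, by omega, by omega⟩
  rcases sgOf_sign δ with hs | hs <;> rw [hs] at ha ⊢ <;> constructor <;> omega

/-- **`M(x + du) ⊆ farAS x du j`** for `j ≤ K` (levels `17r∥ … 23r∥`, transversally `3r⊥ ≤ 5r⊥ − 2`). [cite: KozmaNitzan2024, §4 p. 26 (M_x)] -/
theorem M_add_stepVec_subset_farAS (x : Site 2) (du : MDir) {j : ℕ} (hj : j ≤ P.K) : PCells2T.M P (x + stepVec du) ⊆ PCells2T.farAS P x du j := by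
  intro t ht
  rw [M, mem_aboxS_iff] at ht
  rw [farAS, mem_psBox_iff]
  have h1 := ht du.1
  have h2 := ht (oth du.1)
  rw [P.cenS_add_stepVec_fst] at h1
  rw [P.cenS_add_stepVec_oth] at h2
  have hg := P.sg_c_bound du
  have hsj := P.s_mul_le_r (i := du.1) hj
  have hr : (1 : ℤ) ≤ P.r du.1 := by exact_mod_cast P.one_le_r du.1
  have hr' : (1 : ℤ) ≤ P.r (oth du.1) := by exact_mod_cast P.one_le_r (oth du.1)
  have hr20 : (20 : ℤ) ≤ P.r (oth du.1) := by
    have h := P.twenty_mul_s_le_r (oth du.1); have hs := P.hs (oth du.1)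
    have : (20 : ℕ) ≤ P.r (oth du.1) := le_trans (Nat.le_mul_of_pos_right _ hs) h
    exact_mod_cast this
  push_cast at h1 h2 ⊢
  refine ⟨?_, by constructor <;> linarith [h2.1, h2.2, hg.1, hg.2]⟩
  rcases sgOf_sign du with hs | hs <;> rw [hs] at h1 ⊢ <;> constructor <;> nlinarith [h1.1, h1.2]

/-! ## Narrow ⊆ wide, monotonicity -/

/-- `BtwN ⊆ Btw`. [folklore] -/
theorem BtwN_subset_Btw (v : Site 2) (δ : MDir) : PCells2T.BtwN P v δ ⊆ PCells2T.Btw P v δ :=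
  sBox_mono (sgOf_sign δ) _ le_rfl le_rfl (by omega)

/-- `EfarN ⊆ Efar`. [folklore] -/
theorem EfarN_subset_Efar (v : Site 2) (δ : MDir) : PCells2T.EfarN P v δ ⊆ PCells2T.Efar P v δ :=
  sBox_mono (sgOf_sign δ) _ le_rfl le_rfl (by omega)

/-- `EwvN ⊆ Ewv`. [folklore] -/
theorem EwvN_subset_Ewv (v : Site 2) (δ : MDir) : PCells2T.EwvN P v δ ⊆ PCells2T.Ewv P v δ :=
  Finset.union_subset_union (P.BtwN_subset_Btw v δ) le_rfl

/-- `Btw ⊆ Efar`. [folklore] -/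
theorem Btw_subset_Efar (v : Site 2) (δ : MDir) : PCells2T.Btw P v δ ⊆ PCells2T.Efar P v δ :=
  sBox_mono (sgOf_sign δ) _ le_rfl (by have := P.one_le_r δ.1; omega) le_rfl

/-- `BtwN ⊆ EfarN`. [folklore] -/
theorem BtwN_subset_EfarN (v : Site 2) (δ : MDir) : PCells2T.BtwN P v δ ⊆ PCells2T.EfarN P v δ :=
  sBox_mono (sgOf_sign δ) _ le_rfl (by have := P.one_le_r δ.1; omega) le_rfl

/-- `BtwN ⊆ Efar`. [folklore] -/
theorem BtwN_subset_Efar (v : Site 2) (δ : MDir) : PCells2T.BtwN P v δ ⊆ PCells2T.Efar P v δ :=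
  (P.BtwN_subset_EfarN v δ).trans (P.EfarN_subset_Efar v δ)

/-- `farAN ⊆ EfarN`. [folklore] -/
theorem farAN_subset_EfarN (x : Site 2) (du : MDir) (j : ℕ) : PCells2T.farAN P x du j ⊆ PCells2T.EfarN P x du := by
  refine sBox_mono (sgOf_sign du) _ ?_ le_rfl le_rfl
  nlinarith [P.hs du.1, Nat.zero_le j]

/-- `farAS ⊆ farAN`. [folklore] -/
theorem farAS_subset_farAN (x : Site 2) (du : MDir) (j : ℕ) : PCells2T.farAS P x du j ⊆ PCells2T.farAN P x du j :=
  sBox_mono (sgOf_sign du) _ (by omega) (by omega) (by omega)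

/-- `farAS ⊆ EfarN`. [folklore] -/
theorem farAS_subset_EfarN (x : Site 2) (du : MDir) (j : ℕ) : PCells2T.farAS P x du j ⊆ PCells2T.EfarN P x du :=
  (P.farAS_subset_farAN x du j).trans (P.farAN_subset_EfarN x du j)

/-- `BtwN_{v,δ} ⊆ Cell_v ∪ Cell_{v+δ}`. [folklore] -/
theorem BtwN_subset_Cells (v : Site 2) (δ : MDir) : PCells2T.BtwN P v δ ⊆ PCells2T.Cell P v ∪ PCells2T.Cell P (v + stepVec δ) :=
  (P.BtwN_subset_Btw v δ).trans (P.Btw_subset_Cells v δ)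

/-- The stubs grow with the level. [folklore] -/
theorem Stub_mono (v : Site 2) (δ : MDir) {j j' : ℕ} (h : j ≤ j') : (PCells2T.Stub P v δ j : Finset (Site 2)) ⊆ PCells2T.Stub P v δ j' := by
  intro t ht
  rw [Stub, mem_psBox_iff] at ht ⊢
  obtain ⟨⟨h1, h2⟩, h3, h4⟩ := ht
  have : 10 * (P.s δ.1 : ℤ) * j ≤ 10 * P.s δ.1 * j' := by
    have : (j : ℤ) ≤ j' := by exact_mod_cast h
    nlinarith
  exact ⟨⟨h1, by omega⟩, h3, h4⟩

/-- **`M(x + du) ⊆ farAN x du j`** for `j ≤ K` (through the shrunk far rows `farAS`). [cite: KozmaNitzan2024, §4 p. 26 (M_x)] -/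
theorem M_add_stepVec_subset_farAN (x : Site 2) (du : MDir) {j : ℕ} (hj : j ≤ P.K) : PCells2T.M P (x + stepVec du) ⊆ PCells2T.farAN P x du j :=
  (P.M_add_stepVec_subset_farAS x du hj).trans (P.farAS_subset_farAN x du j)

end PCells2T

end Transplant

end Summit.CriticalPhenomena.PercolationContinuityZ3.Theorems

end
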